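import Mathlib
import HarnessLib
import Literature.Analysis.FluidPDE.SuitableWeak
import Literature.Analysis.FluidPDE.SelfSimilar
import Literature.Analysis.FluidPDE.LocalTypeI
import Literature.Analysis.FluidPDE.NSBoundedMildOseen
import Literature.Analysis.FluidPDE.SlabTypeICompactness
import Summits.NavierStokesRegularity.NavierStokesRegularity.Theorems.RellichScarApexLocalisationRadiationBound
import Summits.NavierStokesRegularity.NavierStokesRegularity.Theorems.RellichScarApexLocalisationApexOfDecaying
import Summits.NavierStokesRegularity.NavierStokesRegularity.Theorems.RellichScarApexLocalisationHullClosed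
import Summits.NavierStokesRegularity.NavierStokesRegularity.Theorems.RellichScarApexLocalisationRateToAncient
import Summits.NavierStokesRegularity.NavierStokesRegularity.Theorems.RellichScarApexLocalisationGlue

/-!
# Reduction of `RellichScar.ApexLocalisation` to the hull-selection bet (line decaying-ancient-bridge)

Crux `Summit.NavierStokesRegularity.NavierStokesRegularity.Theses.RellichScar.ApexLocalisation`
(stmt-NavierStokesRegularity-11719): a rate-Type-I singular suitable weak slab solution with
Albritton–Barker quantity `𝐈 < ⊤` yields a space–time-Type-I (apex) singular one.

This file proves, SORRY-FREE, that the crux follows from ONE remaining statement, the registered stub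
`stub_hullSelection` of the line (THE BET: symmetry-free form of Seregin 2014 Prop. 5.19 / KNSS 2009
(1.4) ⇒ (1.6) — every non-trivial bounded continuous Oseen-mild ancient solution with the rate and
suitable-weak data with `𝐈 < ⊤` has a translation/zoom-in hull limit obeying `‖y‖ ‖N(s,y)‖ ≤ K`),
taken here as the explicit hypothesis `hBet` (verbatim the registered signature). All other stubs of
the line are LANDED theorems and are used by name:

* engine `Literature.Analysis.FluidPDE.slab_typeI_compactness` (A–B 2019 Lemma 2.2 + Prop 2.3 on the slab),
* `stub_rateToAncient` (⇒ transfer: rate profile ⇒ class member, via the Oseen-mild representative),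
* `stub_radiationBound` (near-field radiation bound; it discharges the bet's first hypothesis),
* `stub_hullClosed` (the class is closed under hull limits),
* `stub_apexOfDecaying` (⇐ transfer: blow-down of a shifted-decay solution is an apex profile),

plus the glue `shiftedDecay_of_bounds`, `not_ae_eq_zero_of_continuousOn` (`…Theorems.RellichScarApexLocalisationGlue`). The conclusion is stated as
the UNFOLDED crux (definitionally `RellichScar.ApexLocalisation`; this file does not import the Theses
file so that the eventual `_holds` link cannot close an import cycle).
-/

-- the summit and its single sub-problem share the name (CONVENTIONS §1), as in every Theorems file
set_option linter.dupNamespace false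

namespace Summit.NavierStokesRegularity.NavierStokesRegularity.Theorems.RellichScarApexLocalisation

open MeasureTheory Set Function Metric Filter Topology TopologicalSpace
open scoped ENNReal NNReal
open Literature.Analysis Literature.Analysis.FluidPDE

/-! ### The reduction -/

/-- REDUCTION (line decaying-ancient-bridge): the hull-selection bet `hBet` (verbatim the registered
stub `stub_hullSelection`) implies the crux `RellichScar.ApexLocalisation` (stated unfolded). Proof:
rate profile ⇒ class member (`stub_rateToAncient`, engine `slab_typeI_compactness`) ⇒ hull limit with
the KNSS spatial bound (`hBet`, fed by `stub_radiationBound`) ⇒ again a class member (`stub_hullClosed`)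
⇒ shifted space–time decay (glue) ⇒ blow-down to an apex profile (`stub_apexOfDecaying`). -/
theorem apexLocalisation_of_hullSelection
    (hBet : (∃ c₀ : ℝ, ∀ (I B : ℝ) (M : ℝ → (EuclideanSpace ℝ (Fin 3)) → (EuclideanSpace ℝ (Fin 3))), 0 ≤ I →
            ContinuousOn (uncurry M) (Iio (0 : ℝ) ×ˢ univ) →
            (∀ t < 0, ∀ x : (EuclideanSpace ℝ (Fin 3)), ‖M t x‖ ≤ B) →
            (∀ τ < 0, ∀ (z : (EuclideanSpace ℝ (Fin 3))) (r : ℝ), 0 < r → ∫ y in ball z r, ‖M τ y‖ ^ 2 ≤ I * r) →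
            ∀ (s t : ℝ), s < t → t < 0 → ∀ x : (EuclideanSpace ℝ (Fin 3)), x ≠ 0 →
              ‖∫ τ in Ioo s t, ∫ y in {y : (EuclideanSpace ℝ (Fin 3)) | ‖x‖ / 2 ≤ ‖y - x‖},
                  oseenKernel (t - τ) (x - y) (M τ y) (M τ y)‖ ≤ c₀ * I / ‖x‖) →
          ∀ (C B : ℝ) (M : ℝ → (EuclideanSpace ℝ (Fin 3)) → (EuclideanSpace ℝ (Fin 3))),
            (ContinuousOn (uncurry M) (Iio (0 : ℝ) ×ˢ univ) ∧
              (∀ t < 0, IsWeaklyDivFree (M t)) ∧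
              (∀ s t : ℝ, s < t → t < 0 → ∀ x : (EuclideanSpace ℝ (Fin 3)),
                M t x = UnboundedOperators.heatExtension (M s) (t - s) x - oseenDuhamel 1 s M M t x) ∧
              (∀ t < 0, ∀ x : (EuclideanSpace ℝ (Fin 3)), ‖M t x‖ ≤ B) ∧
              HasTypeITimeDecay C M ∧
              (∃ (q : ℝ → (EuclideanSpace ℝ (Fin 3)) → ℝ) (H : ℝ → (EuclideanSpace ℝ (Fin 3)) → (EuclideanSpace ℝ (Fin 3)) →L[ℝ] (EuclideanSpace ℝ (Fin 3))),
                IsSuitableWeakSolutionOn (slab (EuclideanSpace ℝ (Fin 3)) (Iio 0) isOpen_Iio) 1 0 M q ∧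
                HasWeakSpatialGradientOn (slab (EuclideanSpace ℝ (Fin 3)) (Iio 0) isOpen_Iio) M H ∧
                typeIBound (Iio (0 : ℝ) ×ˢ univ) M q H < ⊤)) →
            (∃ s : ℝ, s < 0 ∧ ∃ y : (EuclideanSpace ℝ (Fin 3)), M s y ≠ 0) →
            ∃ (xk : ℕ → (EuclideanSpace ℝ (Fin 3))) (tk : ℕ → ℝ) (lk : ℕ → ℝ) (N : ℝ → (EuclideanSpace ℝ (Fin 3)) → (EuclideanSpace ℝ (Fin 3))),
              (∀ k, tk k ≤ 0 ∧ 0 < lk k ∧ lk k ≤ 1) ∧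
              (∀ t < 0, TendstoLocallyUniformly
                (fun k (y : (EuclideanSpace ℝ (Fin 3))) => lk k • M (tk k + lk k ^ 2 * t) (xk k + lk k • y)) (N t) atTop) ∧
              ContinuousOn (uncurry N) (Iio (0 : ℝ) ×ˢ univ) ∧
              (∃ s : ℝ, s < 0 ∧ ∃ y : (EuclideanSpace ℝ (Fin 3)), N s y ≠ 0) ∧
              ∃ K : ℝ, ∀ s < 0, ∀ y : (EuclideanSpace ℝ (Fin 3)), ‖y‖ * ‖N s y‖ ≤ K) :
    ∀ C : ℝ, (∃ (u : ℝ → EuclideanSpace ℝ (Fin 3) → EuclideanSpace ℝ (Fin 3)) (p : ℝ → EuclideanSpace ℝ (Fin 3) → ℝ) (G : ℝ → EuclideanSpace ℝ (Fin 3) → EuclideanSpace ℝ (Fin 3) →L[ℝ] EuclideanSpace ℝ (Fin 3)), Literature.Analysis.FluidPDE.IsSuitableWeakSolutionOn (Literature.Analysis.FluidPDE.slab (EuclideanSpace ℝ (Fin 3)) (Set.Iio 0) isOpen_Iio) 1 0 u p ∧ Literature.Analysis.FluidPDE.HasWeakSpatialGradientOn (Literature.Analysis.FluidPDE.slab (EuclideanSpace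 ℝ (Fin 3)) (Set.Iio 0) isOpen_Iio) u G ∧ Literature.Analysis.FluidPDE.typeIBound (Set.Iio (0 : ℝ) ×ˢ Set.univ) u p G < ⊤ ∧ Literature.Analysis.FluidPDE.HasTypeITimeDecay C u ∧ Literature.Analysis.FluidPDE.IsBackwardSingularPoint u 0) → ∃ (C' : ℝ) (u : ℝ → EuclideanSpace ℝ (Fin 3) → EuclideanSpace ℝ (Fin 3)) (p : ℝ → EuclideanSpace ℝ (Fin 3) → ℝ) (G : ℝ → EuclideanSpace ℝ (Fin 3) → EuclideanSpace ℝ (Fin 3) →L[ℝ] EuclideanSpace ℝ (Fin 3)), Literature.Analysis.FluidPDE.IsSuitableWeakSolutionOn (Literature.Analysis.FluidPDE.slab (EuclideanSpace ℝ (Fin 3)) (Set.Iio 0) isOpen_Iio) 1 0 u p ∧ Literature.Analysis.FluidPDE.HasWeakSpatialGradientOn (Literature.Analysis.FluidPDE.slab (EuclideanSpace ℝ (Fin 3)) (Set.Iio 0) isOpen_Iio) u G ∧ Literature.Analysis.FluidPDE.typeIBound (Set.Iio (0 : ℝ) ×ˢ Set.univ) u p G < ⊤ ∧ Literature.Analysis.FluidPDE.HasTypeIDecay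 C' u ∧ Literature.Analysis.FluidPDE.IsBackwardSingularPoint u 0 := by
  intro C hRate
  -- ⇒ transfer: a non-trivial bounded decaying ancient solution of the class 𝒜(C,B)
  obtain ⟨B, M, hM, hMnt⟩ := stub_rateToAncient slab_typeI_compactness C hRate
  -- the bet: a hull limit with the KNSS spatial bound
  obtain ⟨xk, tk, lk, N, hadm, hconv, hNcont, hNnt, K, hK⟩ :=
    hBet stub_radiationBound C B M hM hMnt
  -- hull closure: the limit is again in the class
  obtain ⟨-, -, -, hNB, hNC, q, H, hsws, hgrad, hI⟩ :=
    stub_hullClosed slab_typeI_compactness C B M xk tk lk N hM hadm hconv hNcont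
  -- glue: shifted space–time decay and a.e.-non-triviality
  have hdecay := shiftedDecay_of_bounds hNB hNC hK
  obtain ⟨s, hs, y, hy⟩ := hNnt
  have hnt := not_ae_eq_zero_of_continuousOn hNcont hs hy
  -- ⇐ transfer: blow down to an apex profile
  exact stub_apexOfDecaying slab_typeI_compactness ⟨B + C + K, N, q, H, hsws, hgrad, hI, hnt, hdecay⟩

end Summit.NavierStokesRegularity.NavierStokesRegularity.Theorems.RellichScarApexLocalisation
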